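import Summits.BirchSwinnertonDyer.Rank1Residual.X11a.SelmerCompanionTateLines
import Summits.BirchSwinnertonDyer.Rank1Residual.X11a.SelmerCompanionStrictCertificateAtP
import HarnessLib

/-!
# Route (3e) SELMER COMPANION, XXXII: strictness at a place where the transported condition is
# the Tate line of `E` — the certificate for shape G (class X11a = N7; cell `b2b-bsdres`,
# unit `b2b-bsdres-x11a`, gen 31)

HONEST FRAMING (run/shared/lean/b2b/bsd-rank1-residual/, verbatim in every file): the goal of the
cell is to DELETE the COMBINATION-SHAPED residual classes of the Birch–Swinnerton-Dyer formula for
ALL analytic-rank `≤ 1` elliptic curves over `ℚ` — "full BSD formula for every rank `≤ 1` curve in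
class `C`" assembled STRICTLY from published theorems — so that the rank-`≤ 1` remainder becomes
exactly the CONSTRUCTION-SHAPED classes, which are TYPED (missing-input `Prop`s), NOT attempted.
This is not "finishing BSD". CLASS-OWNERS.md: research routes; NO CLAIM BEYOND STATED CLASSES.
THEOREMS ONLY (no definition, no named fact, no `sorry`); nothing is booked by this file; no label
moves. General (any number field `K`, any prime `p`, any finite place `v`) and cell-independent.

## What this file proves

The census of gen 31 (`HOME/b2b-bsdres-x11a/g31/SELMER-COMPANION-CENSUS-v9.md` §3) isolates the
N7 residue cells whose ONLY lossy place is a FULL-`p`-TORSION level-raising place `v ∤ p` of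
`E = W'` (`E` split multiplicative at `v` with `E(K_v)[p] = E[p]`, the partner `A = W` GOOD at `v`)
served by a CLOSED RANK-ONE partner (137577k1 ← 1210a1 @379, 240306e1 ← 1210a1 @331,
145824bh1/w1 ← 1568h1 @31, 289338m1 ← 13778a1 @7, all at `p = 3`). There the transported condition
`θ_* 𝓢_v(E)` and `𝓢_v(A)` meet in a LINE (comparison index `p`, discrepancy `1`), so the factor
`#Sel^(p)(A) = p` of the count of file I must be removed by STRICTNESS: no non-zero Selmer class
of `A` lies in `θ_* 𝓢_v(E)` (the hypothesis `hstrict` of the refined count, file XIII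
`natCard_selmerGroup_le_of_congr_inf` / `…_strict`). This file derives that strictness from a
finite certificate, in the manner of file XXI (`strict_at_p_of_kummerClass`, the kernel-of-
reduction line at `p`) with the kernel of reduction REPLACED by the transported Tate line:

* `strict_of_kummerClass_of_sub_mem` — ABSTRACT form: `#Sel^(p)(A/K) = p`, `Sel^(p)(A)` contains
  the Kummer class of a point `Q` with `pQ` rational, `Λ` any set of local points closed under
  `ℤ`-multiples; if NO `p`-th root `c ∈ A(K̄_v)` of the image of `pQ` satisfies `σc − c ∈ Λ` for
  all `σ ∈ Γ_{K_v}` (`hcert`), then every Selmer class of `A` which over `Γ_{K_v}` is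
  `σ ↦ (σb − b)` with `σb − b ≡ σt − t (mod Λ)` for a `p`-torsion local point `t` is ZERO. (A group
  of prime order is generated by any non-zero element; file XXI's five-line argument.)
* `h1Equiv_eq_zero_of_selmer_of_tateLine_certificate` — **strictness at a Tate-line place**: with
  `Φ' : K̄_v^* → E(K̄_v)` an equivariant Tate datum of `E` at `v` whose `K_v`-points come from
  `K_v^*` (Silverman *ATAEC* V.3.1/V.5.3, named fact A40), `θ : E[p] ≃ A[p]`, `#Sel^(p)(A) = p ∋ κ(Q)`,
  and the certificate `hcert`: no `p`-th root `c` of `(pQ)_v` in `A(K̄_v)` has ALL `σc − c` in the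
  transported Tate line `{θΦ'(ζ) : ζ^p = 1}` — then `Sel^(p)(A) ∩ θ_* 𝓢_v(E) = 0`. Proof: a class
  of `𝓢_v(E)` is locally `σ ↦ Φ'(σw/w) + (σT₀ − T₀)` (file XXXI / kind (ii)); if its transport is
  Selmer for `A` it is locally `∂b`, so `σb − b − (σt − t) = θΦ'(σw/w)` with `t = θT₀`, and the
  abstract form applies.

What is NOT in this file (successor's kernel items, REPORT-g31 §4): (G1) the comparison index at
such a place is `≤ p` (not the crude `#E(K_v)[p] = p²` the census charges), needed for the budget;
(G3) the residue-field reading of `hcert` (it is the finite check "`Frob(μ) − μ ∉ Λ̃` for a `p`-th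
root `μ` of `g̃` in `Ã(𝔽_{ℓ³})`", certified 29/29 by PARI kit j144468 on the five cells above).
Nothing is booked; no label moves.

## References

* [SilvermanAEC2009] J. H. Silverman, *The Arithmetic of Elliptic Curves*, 2nd ed., VIII.§2
  (Kummer pairing), X.§4 diagram (**).
* [SilvermanATAEC1994] *Advanced Topics*, Ch. V Thm. 3.1 (c),(d), Thm. 5.3; Ch. IV Rem. 9.6.
* [MazurRubin2004] B. Mazur, K. Rubin, *Kolyvagin systems*, Mem. AMS 799 (2004), §2.3.
* Tree: files XIII, XXI, XXXI of the route; HOME/b2b-bsdres-x11a/REPORT-g31.md.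
-/

set_option autoImplicit false

noncomputable section

open scoped Classical

open WeierstrassCurve Literature.NumberTheory.EllipticCurves
  Literature.NumberTheory.GaloisRepresentations Field NumberField IsDedekindDomain

namespace Summit.BirchSwinnertonDyer.Rank1Residual.X11a.SelmerCompanion

section Local

variable {K : Type} [Field K] [NumberField K] (A : WeierstrassCurve K)
  {p : ℕ} [hp : Fact p.Prime] (v : HeightOneSpectrum (𝓞 K))

/-- **Strictness from a certificate, abstract form** (file XXI's `strict_at_p_of_kummerClass`
with the kernel of reduction replaced by an arbitrary `ℤ`-stable set `Λ` of local points and a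
`p`-torsion slack `t`). Let `#Sel^(p)(A/K) = p` and let `Sel^(p)(A)` contain the Kummer class of
`Q ∈ A(K̄)` with `pQ` rational. If for every `c ∈ A(K̄_v)` with `p c = (pQ)_v` some
`σ ∈ Γ_{K_v}` has `σc − c ∉ Λ` (`hcert`), then every Selmer class of `A` whose cocycle is over
`Γ_{K_v}` the coboundary of a point `b` with `σb − b − (σt − t) ∈ Λ` for all `σ` (`t` a local
point killed by `p`) is ZERO: in the group `Sel^(p)(A)` of prime order `κ(Q) = k[ψ]`, so
`c = Q + T − k t` (`T ∈ A[p]` from the coboundary relating the cocycles) has `pc = pQ` and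
`σc − c = k(σb − b − (σt − t)) ∈ Λ` for all `σ`, contradicting `hcert`.
[cite: SilvermanAEC2009, VIII.§2 and X.§4 diagram (**)] [cite: MazurRubin2004, §2.3] -/
theorem strict_of_kummerClass_of_sub_mem
    (hSel : Nat.card (A.selmerGroup (p : ℤ)) = p)
    {Q : geomPoints A}
    (hQ : (p : ℤ) • Q ∈ MulAction.fixedPoints (absoluteGaloisGroup K) (geomPoints A))
    (hs : kummerClassTorsion A (p : ℤ) Q hQ ∈ A.selmerGroup (p : ℤ))
    (Λ : Set (localPoints A (v.adicCompletion K)))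
    (hΛ : ∀ x ∈ Λ, ∀ k : ℤ, k • x ∈ Λ)
    (hcert : ∀ c : localPoints A (v.adicCompletion K),
      (p : ℤ) • c = pointsMap A (v.adicCompletion K) ((p : ℤ) • Q) →
      ∃ σ : absoluteGaloisGroup (v.adicCompletion K), σ • c - c ∉ Λ)
    (ψ : contOneCocycles (discreteTopRep (absoluteGaloisGroup K) (geomTorsion A (p : ℤ))))
    (hψ : oneCocycleClass _ ψ ∈ A.selmerGroup (p : ℤ))
    (b t : localPoints A (v.adicCompletion K)) (ht : (p : ℤ) • t = 0)
    (hb : ∀ σ : absoluteGaloisGroup (v.adicCompletion K), pointsMap A (v.adicCompletion K)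
      ((ψ.1 (resGal (K := K) (v.adicCompletion K) σ) : geomTorsion A (p : ℤ)) : geomPoints A)
        = σ • b - b)
    (hbk : ∀ σ : absoluteGaloisGroup (v.adicCompletion K), σ • b - b - (σ • t - t) ∈ Λ) :
    oneCocycleClass _ ψ = 0 := by
  by_contra h0
  haveI : Finite (A.selmerGroup (p : ℤ)) :=
    Nat.finite_of_card_ne_zero (by rw [hSel]; exact hp.out.ne_zero)
  -- `κ(Q) = k [ψ]` in the group `Sel^(p)(A)` of prime order
  obtain ⟨k, hk⟩ := OrdinaryLine.exists_zsmul_eq_of_card_prime (p := p) (A.selmerGroup (p : ℤ)) hSel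
    hψ h0 hs
  -- on cocycles: `k ψ - κ_Q = ∂T`, `T ∈ A[p]`
  have hcl : oneCocycleClass _ (k • ψ - kummerCocycleTorsion A (p : ℤ) Q hQ) = 0 := by
    rw [oneCocycleClass_sub, ← oneCocycleClassₗ_apply, map_zsmul, oneCocycleClassₗ_apply, hk]
    exact sub_eq_zero.mpr rfl
  obtain ⟨T, hT⟩ := (oneCocycleClass_eq_zero_iff _ _).mp hcl
  have hTσ : ∀ σ : absoluteGaloisGroup K,
      k • ((ψ.1 σ : geomTorsion A (p : ℤ)) : geomPoints A) - (σ • Q - Q) =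
        σ • ((T : geomTorsion A (p : ℤ)) : geomPoints A) - T := by
    intro σ
    have h1 := hT σ
    rw [discreteTopRep_ρ_apply] at h1
    have h2 := congrArg (fun x : geomTorsion A (p : ℤ) ↦ (x : geomPoints A)) h1
    change (((k • ψ.1 σ - (kummerCocycleTorsion A (p : ℤ) Q hQ).1 σ : geomTorsion A (p : ℤ)) :
        geomPoints A)) = ((σ • T - T : geomTorsion A (p : ℤ)) : geomPoints A) at h2
    rwa [AddSubgroupClass.coe_sub, AddSubgroupClass.coe_zsmul, coe_kummerCocycleTorsion_apply,
      AddSubgroupClass.coe_sub,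
      Literature.NumberTheory.EllipticCurves.AddSubgroup.torsionBy.coe_smul] at h2
  -- over `Γ_{K_v}`: `c = Q + T - k t` has `p c = p Q` and `σ c - c = k (σ b - b - (σ t - t)) ∈ Λ`
  have hT'p : (p : ℤ) • pointsMap A (v.adicCompletion K) ((T : geomTorsion A (p : ℤ)) :
      geomPoints A) = 0 := by
    rw [← map_zsmul, (mem_geomTorsion_iff A _ _).mp T.2, map_zero]
  have hloc : ∀ σ : absoluteGaloisGroup (v.adicCompletion K),
      σ • (pointsMap A (v.adicCompletion K) Q +
          pointsMap A (v.adicCompletion K) ((T : geomTorsion A (p : ℤ)) : geomPoints A) - k • t) -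
        (pointsMap A (v.adicCompletion K) Q +
          pointsMap A (v.adicCompletion K) ((T : geomTorsion A (p : ℤ)) : geomPoints A) - k • t) =
        k • (σ • b - b - (σ • t - t)) := by
    intro σ
    have h := congrArg (pointsMap A (v.adicCompletion K))
      (hTσ (resGal (K := K) (v.adicCompletion K) σ))
    rw [map_sub, map_zsmul, hb σ, map_sub, pointsMap_smul, map_sub, pointsMap_smul,
      sub_eq_iff_eq_add] at h
    rw [smul_sub, smul_add, A.smul_zsmul_localPoints k σ t, zsmul_sub, h, zsmul_sub]
    abel
  obtain ⟨σ₀, hσ₀⟩ := hcert (pointsMap A (v.adicCompletion K) Q +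
      pointsMap A (v.adicCompletion K) ((T : geomTorsion A (p : ℤ)) : geomPoints A) - k • t)
    (by rw [zsmul_sub, smul_add, hT'p, add_zero, map_zsmul, smul_comm, ht, smul_zero, sub_zero])
  have hmem : k • (σ₀ • b - b - (σ₀ • t - t)) ∈ Λ := hΛ _ (hbk σ₀) k
  rw [← hloc σ₀] at hmem
  exact hσ₀ hmem

variable (W' : WeierstrassCurve K) [W'.IsElliptic]

/-- **Strictness at a Tate-line place (shape G certificate).** Let `E = W'` carry an equivariant
Tate datum `Φ' : K̄_v^* → E(K̄_v)` at `v` whose `K_v`-rational points come from `K_v^*` (Silverman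
*ATAEC* V.3.1/V.5.3 at a place of split multiplicative reduction), `θ : E[p] ≃ A[p]`
`Γ_K`-equivariant, `#Sel^(p)(A/K) = p` with `Sel^(p)(A) ∋ κ(Q)` (`pQ` rational). CERTIFICATE
`hcert`: for every `c ∈ A(K̄_v)` with `p c = (pQ)_v` there is `σ ∈ Γ_{K_v}` with `σc − c` NOT of
the form `θΦ'(ζ)`, `ζ^p = 1` (the transported Tate line; at a good place `v ∤ p` of `A` with full
`p`-torsion this reads in `Ã(𝔽_v)`: `Frob(μ) − μ ∉ Λ̃` for one `p`-th root `μ` of `g̃` over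
`𝔽_{q_v^p}` — engine-certified, module docstring). Then **no non-zero class of `Sel^(p)(A)` lies in
`θ_* 𝓢_v(E)`**: every `c' ∈ 𝓢_v(E)` with `θ_* c' ∈ Sel^(p)(A)` has `θ_* c' = 0` (the hypothesis
`hstrict` of file XIII's strict count). Proof in the module docstring.
[cite: SilvermanATAEC1994, Ch. V Thm. 3.1 (c),(d), Thm. 5.3] [cite: SilvermanAEC2009, VIII.§2, X.§4]
[cite: MazurRubin2004, §2.3] -/
theorem h1Equiv_eq_zero_of_selmer_of_tateLine_certificate [A.IsElliptic] (hn : (p : ℤ) ≠ 0)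
    (θ : geomTorsion W' (p : ℤ) ≃+ geomTorsion A (p : ℤ))
    (hθ : ∀ (σ : absoluteGaloisGroup K) (P : geomTorsion W' (p : ℤ)), θ (σ • P) = σ • θ P)
    (Φ' : Additive (AlgebraicClosure (v.adicCompletion K))ˣ →+ localPoints W' (v.adicCompletion K))
    (hequiv' : ∀ (σ : absoluteGaloisGroup (v.adicCompletion K))
        (u : (AlgebraicClosure (v.adicCompletion K))ˣ),
      σ • Φ' (Additive.ofMul u) = Φ' (Additive.ofMul (Units.map
        (absoluteGaloisGroup.toAlgEquiv _ σ : AlgebraicClosure (v.adicCompletion K) →*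
          AlgebraicClosure (v.adicCompletion K)) u)))
    (hrat' : ∀ P : localPoints W' (v.adicCompletion K),
      (∀ σ : absoluteGaloisGroup (v.adicCompletion K), σ • P = P) →
      ∃ u : (v.adicCompletion K)ˣ, Φ' (Additive.ofMul (Units.map (algebraMap (v.adicCompletion K)
        (AlgebraicClosure (v.adicCompletion K)) : v.adicCompletion K →*
          AlgebraicClosure (v.adicCompletion K)) u)) = P)
    (hSel : Nat.card (A.selmerGroup (p : ℤ)) = p)
    {Q : geomPoints A}
    (hQ : (p : ℤ) • Q ∈ MulAction.fixedPoints (absoluteGaloisGroup K) (geomPoints A))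
    (hs : kummerClassTorsion A (p : ℤ) Q hQ ∈ A.selmerGroup (p : ℤ))
    (hcert : ∀ c : localPoints A (v.adicCompletion K),
      (p : ℤ) • c = pointsMap A (v.adicCompletion K) ((p : ℤ) • Q) →
      ∃ σ : absoluteGaloisGroup (v.adicCompletion K),
        ∀ (ζ : (AlgebraicClosure (v.adicCompletion K))ˣ), ζ ^ p = 1 →
        ∀ hζ : Φ' (Additive.ofMul ζ) ∈
            AddSubgroup.torsionBy (localPoints W' (v.adicCompletion K)) (p : ℤ),
          σ • c - c ≠ pointsMap A (v.adicCompletion K)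
            ((θ ((W'.torsionPointsEquiv (p : ℤ) (E := v.adicCompletion K) hn).symm
              ⟨Φ' (Additive.ofMul ζ), hζ⟩) : geomTorsion A (p : ℤ)) : geomPoints A))
    {c' : galH1Torsion W' (p : ℤ)} (hc' : c' ∈ selmerLocalKer W' (v.adicCompletion K) (p : ℤ))
    (hsel : h1Equiv θ hθ c' ∈ A.selmerGroup (p : ℤ)) :
    h1Equiv θ hθ c' = 0 := by
  have hpp : p.Prime := hp.out
  haveI : NeZero p := ⟨hpp.ne_zero⟩
  haveI : CharZero (v.adicCompletion K) := charZero_adicCompletion v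
  haveI : CharZero (AlgebraicClosure (v.adicCompletion K)) := charZero_of_injective_algebraMap
      (algebraMap (v.adicCompletion K) (AlgebraicClosure (v.adicCompletion K))).injective
  -- the transport `G = pointsMap ∘ θ ∘ e'⁻¹` and the line `Λ = {G(Φ'(ζ)) : ζ^p = 1}`
  set e' := W'.torsionPointsEquiv (p : ℤ) (E := (v.adicCompletion K)) hn with he'
  set G : AddSubgroup.torsionBy (localPoints W' (v.adicCompletion K)) (p : ℤ) →+ localPoints A
      (v.adicCompletion K) :=
    ((pointsMap A (v.adicCompletion K)).comp (geomTorsion A (p : ℤ)).subtype).comp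
      (θ.toAddMonoidHom.comp e'.symm.toAddMonoidHom) with hG
  have hG_apply : ∀ T, G T = pointsMap A (v.adicCompletion K) ((θ (e'.symm T) : geomTorsion A
      (p : ℤ)) : geomPoints A) := fun T ↦ rfl
  have hmem' : ∀ {ζ : (AlgebraicClosure (v.adicCompletion K))ˣ}, ζ ^ p = 1 →
      Φ' (Additive.ofMul ζ) ∈ AddSubgroup.torsionBy (localPoints W' (v.adicCompletion K)) (p : ℤ) :=
    fun hζ ↦ (Submodule.mem_torsionBy_iff _ _).mpr
        (W'.zsmul_map_ofMul_eq_zero_of_pow_eq_one v Φ' hζ)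
  set Λ : Set (localPoints A (v.adicCompletion K)) :=
    {x | ∃ (ζ : (AlgebraicClosure (v.adicCompletion K))ˣ) (hζ : ζ ^ p = 1),
      x = G ⟨Φ' (Additive.ofMul ζ), hmem' hζ⟩} with hΛ
  have hΛz : ∀ x ∈ Λ, ∀ k : ℤ, k • x ∈ Λ := by
    rintro x ⟨ζ, hζ, rfl⟩ k
    refine ⟨ζ ^ k, by rw [← zpow_natCast, ← zpow_mul, mul_comm, zpow_mul, zpow_natCast, hζ,
      one_zpow], ?_⟩
    rw [← map_zsmul]
    congr 1
    apply Subtype.ext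
    rw [AddSubgroupClass.coe_zsmul]
    change k • Φ' (Additive.ofMul ζ) = Φ' (Additive.ofMul (ζ ^ k))
    rw [ofMul_zpow, map_zsmul]
  -- the certificate in terms of `Λ`
  have hcertΛ : ∀ c : localPoints A (v.adicCompletion K),
      (p : ℤ) • c = pointsMap A (v.adicCompletion K) ((p : ℤ) • Q) →
      ∃ σ : absoluteGaloisGroup (v.adicCompletion K), σ • c - c ∉ Λ := by
    intro c hc
    obtain ⟨σ, hσ⟩ := hcert c hc
    refine ⟨σ, ?_⟩
    rintro ⟨ζ, hζ, hx⟩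
    exact hσ ζ hζ (hmem' hζ) (by rw [hx, hG_apply])
  -- the class `c'`, its cocycle `φ` and the Tate form `φ(res σ) = e'⁻¹ Φ'(ζ_σ) + (σ T₀ - T₀)`
  obtain ⟨φ, rfl⟩ :=
    oneCocycleClass_surjective (discreteTopRep (absoluteGaloisGroup K) (geomTorsion W' (p : ℤ))) c'
  have hc := hc'
  rw [selmerLocalKer, oneCocycleClass_mem_resKer_iff] at hc
  obtain ⟨a', ha'⟩ := hc
  have ha'' : ∀ σ : (absoluteGaloisGroup (v.adicCompletion K)), pointsMap W' (v.adicCompletion K)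
      ((φ.1 (resGal (K := K) (v.adicCompletion K) σ) : geomTorsion W' (p : ℤ)) :
      geomPoints W') = σ • a' - a' := fun σ ↦ ha' σ
  have hP'fix : ∀ σ : (absoluteGaloisGroup (v.adicCompletion K)), σ • ((p : ℤ) • a') =
      (p : ℤ) • a' := by
    intro σ
    have h0 : (p : ℤ) • (σ • a' - a') = 0 := by
      rw [← ha'' σ, ← map_zsmul, (mem_geomTorsion_iff W' _ _).mp (φ.1 _).2, map_zero]
    rw [W'.smul_zsmul_localPoints (p : ℤ) σ a']
    rw [zsmul_sub, sub_eq_zero] at h0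
    exact h0
  obtain ⟨u, hu⟩ := hrat' ((p : ℤ) • a') hP'fix
  set uu : (AlgebraicClosure (v.adicCompletion K))ˣ := Units.map (algebraMap (v.adicCompletion K)
      (AlgebraicClosure (v.adicCompletion K)) : (v.adicCompletion K) →* (AlgebraicClosure
      (v.adicCompletion K))) u with huu
  have huu0 : (uu : (AlgebraicClosure (v.adicCompletion K))) ≠ 0 := uu.ne_zero
  obtain ⟨z, hz⟩ := IsAlgClosed.exists_pow_nat_eq (uu : (AlgebraicClosure
      (v.adicCompletion K))) hpp.pos
  have hz0 : z ≠ 0 := by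
    rintro rfl
    rw [zero_pow hpp.ne_zero] at hz
    exact huu0 hz.symm
  set w : (AlgebraicClosure (v.adicCompletion K))ˣ := Units.mk0 z hz0 with hw
  have hwp : w ^ p = uu := Units.ext (by rw [Units.val_pow_eq_pow_val, hw, Units.val_mk0, hz])
  set R' : localPoints W' (v.adicCompletion K) := Φ' (Additive.ofMul w) with hR'
  have hR'p : (p : ℤ) • R' = (p : ℤ) • a' := by
    rw [hR', ← map_zsmul, ← ofMul_zpow, zpow_natCast, hwp, huu, hu]
  set T : localPoints W' (v.adicCompletion K) := a' - R' with hT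
  have hTp : (p : ℤ) • T = 0 := by rw [hT, zsmul_sub, hR'p, sub_self]
  set Tt : AddSubgroup.torsionBy (localPoints W' (v.adicCompletion K)) (p : ℤ) :=
    ⟨T, (Submodule.mem_torsionBy_iff _ _).mpr hTp⟩ with hTt
  set T₀ : geomTorsion W' (p : ℤ) := e'.symm Tt with hT₀
  have hT₀ : pointsMap W' (v.adicCompletion K) (T₀ : geomPoints W') = T := by
    rw [hT₀, he', W'.pointsMap_torsionPointsEquiv_symm (p : ℤ) hn Tt]
  have hσuu : ∀ σ : (absoluteGaloisGroup (v.adicCompletion K)),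
      (absoluteGaloisGroup.toAlgEquiv _ σ : AlgebraicClosure (v.adicCompletion K) →*
        AlgebraicClosure (v.adicCompletion K)) (uu : (AlgebraicClosure (v.adicCompletion K))) = uu := by
    intro σ
    rw [huu, Units.coe_map, MonoidHom.coe_coe, MonoidHom.coe_coe, AlgEquiv.commutes]
  have hζσ : ∀ σ : (absoluteGaloisGroup (v.adicCompletion K)), (Units.map
      (absoluteGaloisGroup.toAlgEquiv _ σ : AlgebraicClosure (v.adicCompletion K)
      →* AlgebraicClosure (v.adicCompletion K)) w / w) ^ p = 1 := by
    intro σ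
    apply Units.ext
    rw [Units.val_pow_eq_pow_val, Units.val_div_eq_div_val, div_pow, Units.coe_map, ← map_pow,
      ← Units.val_pow_eq_pow_val, hwp, hσuu, div_self huu0, Units.val_one]
  have hφσ : ∀ σ : (absoluteGaloisGroup (v.adicCompletion K)), φ.1 (resGal (K := K)
      (v.adicCompletion K) σ) =
      e'.symm ⟨Φ' (Additive.ofMul (Units.map
          (absoluteGaloisGroup.toAlgEquiv _ σ : AlgebraicClosure (v.adicCompletion K)
          →* AlgebraicClosure (v.adicCompletion K)) w / w)), hmem' (hζσ σ)⟩ +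
        (resGal (K := K) (v.adicCompletion K) σ • T₀ - T₀) := by
    intro σ
    apply Subtype.ext
    apply pointsMapOfEmb_injective W' (closureEmb (K := K) (v.adicCompletion K))
    change pointsMap W' (v.adicCompletion K) _ = pointsMap W' (v.adicCompletion K) _
    rw [ha'' σ, AddSubgroup.coe_add, AddSubgroup.coe_sub, map_add, map_sub,
      Literature.NumberTheory.EllipticCurves.AddSubgroup.torsionBy.coe_smul, pointsMap_smul, hT₀,
      he', W'.pointsMap_torsionPointsEquiv_symm (p : ℤ) hn]
    change σ • a' - a' = Φ' (Additive.ofMul (Units.map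
        (absoluteGaloisGroup.toAlgEquiv _ σ : AlgebraicClosure (v.adicCompletion K)
        →* AlgebraicClosure (v.adicCompletion K)) w / w)) + (σ • T - T)
    rw [ofMul_div, map_sub, ← hequiv' σ w, ← hR', hT, smul_sub]
    abel
  -- the transported cocycle `ψ = θ ∘ φ` (class `θ_* c'`, Selmer for `A`) is locally `∂b`
  set ψ := contOneCocycles.pullback (ContinuousMonoidHom.id (absoluteGaloisGroup K))
    (resHomOfEquivariant (ContinuousMonoidHom.id (absoluteGaloisGroup K))
      (θ : geomTorsion W' (p : ℤ) →+ geomTorsion A (p : ℤ)) hθ) φ with hψdef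
  have hψcl : oneCocycleClass _ ψ = h1Equiv θ hθ (oneCocycleClass _ φ) := by
    rw [h1Equiv_oneCocycleClass]
  have hψapp : ∀ σ, ψ.1 σ = θ (φ.1 σ) := fun σ ↦ rfl
  have hψsel : oneCocycleClass _ ψ ∈ A.selmerGroup (p : ℤ) := by rw [hψcl]; exact hsel
  have hψv : oneCocycleClass _ ψ ∈ selmerLocalKer A (v.adicCompletion K) (p : ℤ) := by
    rw [hψcl]; exact ((mem_selmerGroup_iff A _ _).mp hsel).1 v
  rw [selmerLocalKer, oneCocycleClass_mem_resKer_iff] at hψv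
  obtain ⟨b, hb⟩ := hψv
  have hb' : ∀ σ : absoluteGaloisGroup (v.adicCompletion K), pointsMap A (v.adicCompletion K)
      ((ψ.1 (resGal (K := K) (v.adicCompletion K) σ) : geomTorsion A (p : ℤ)) : geomPoints A)
        = σ • b - b := fun σ ↦ hb σ
  -- the slack `t = θ T₀` and the identity `σb - b - (σt - t) = G(Φ'(ζ_σ)) ∈ Λ`
  set t : localPoints A (v.adicCompletion K) :=
    pointsMap A (v.adicCompletion K) ((θ T₀ : geomTorsion A (p : ℤ)) : geomPoints A) with htdef
  have htp : (p : ℤ) • t = 0 := by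
    rw [htdef, ← map_zsmul, (mem_geomTorsion_iff A _ _).mp (θ T₀).2, map_zero]
  have hbk : ∀ σ : absoluteGaloisGroup (v.adicCompletion K), σ • b - b - (σ • t - t) ∈ Λ := by
    intro σ
    refine ⟨_, hζσ σ, ?_⟩
    rw [← hb' σ, hψapp, hφσ σ, map_add, map_sub, AddSubgroup.coe_add, AddSubgroup.coe_sub,
      map_add, map_sub, ← hG_apply, hθ,
      Literature.NumberTheory.EllipticCurves.AddSubgroup.torsionBy.coe_smul, pointsMap_smul, ← htdef]
    abel
  rw [← hψcl]
  exact strict_of_kummerClass_of_sub_mem A v hSel hQ hs Λ hΛz hcertΛ ψ hψsel b t htp hb' hbk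

end Local

end Summit.BirchSwinnertonDyer.Rank1Residual.X11a.SelmerCompanion

end
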